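import Literature.MathematicalPhysics.PowerSystems.LuriePostnikovSlabCertificate
import Literature.Analysis.ODE.LyapunovExponentialDecay
import HarnessLib

/-!
# The certified DECAY RATE of a Lur'e–Postnikov slab certificate: exponential convergence inside
# the certified well (Khalil Thm 4.10 applied to Pai's «quadratic plus integral of nonlinearity» V)

Topic `Literature/MathematicalPhysics/PowerSystems`, namespace
`Literature.MathematicalPhysics.PowerSystems.LyapunovFunctionFamily` (the `System = (A, B, C, δ*)`,
`ẋ = Ax − BF(Cx)` language and the certificate class `SlabCertificate` of
`LuriePostnikovSlabCertificate.lean`, reused BY NAME). Everything is PROVED (no named fact, one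
definition = the upper comparison matrix).

SOURCES (read on the page). H. K. Khalil, *Nonlinear Systems*, 3rd ed. (2002), §4.5 Theorem 4.10
(galaxy:panama:393504903659633 chunk p0113) [Khalil2002]: `k₁‖x‖ᵃ ≤ V ≤ k₂‖x‖ᵃ`, `V̇ ≤ −k₃‖x‖ᵃ` on
`D` ⇒ `‖x(t)‖ ≤ (k₂/k₁)^{1/a}‖x(t₀)‖e^{−(k₃/(k₂a))(t−t₀)}` — typed in the tree as
`Literature/Analysis/ODE/LyapunovExponentialDecay.lean` (`gauge_le_mul_exp_neg_of_solution`).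
M. A. Pai, *Power System Stability* (1981), §2.16 Theorem [18] eq. (2.63)
(galaxy-panama-498241976139844 chunk p0040) [Pai1981]: `V(x) = xᵀPx + ∫₀^σ fᵀ(σ)Q dσ`; §2.15
(2.47)–(2.48) (chunk p0036): the sector condition `0 ≤ σ f(σ) ≤ k σ²`.

WHAT IS PROVED. For a slab certificate `Λ = (P, ε, η, τ, lam, a, b)` of `S` — recall its FIELDS
`P − ε·1 ⪰ 0` (`ε > 0`) and the certified decay `V̇ ≤ −η|x|²` on the slab (`η > 0`,
`vdot_le_of_slab`) — and the sector hypothesis `hsec` of `well_subset_regionOfAttraction`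
(`a_k ≤ cos ξ ≤ b_k` on `|ξ − δ*_k| ≤ γ_k`):

* §1 `popov_term_le` — the Popov integral is at most `(b/2)·y²` on the window:
  `cos δ* − cos(δ* + y) − y sin δ* ≤ (b/2) y²` for `|y| ≤ γ` when `cos ξ ≤ b` on `|ξ − δ*| ≤ γ`
  (mean value theorem twice: `∫₀^y F` with `F(u) = u·cos ξ_u ≤ b·u` in the sense of the sector);
* §2 `SlabCertificate.upperMatrix Λ = P + Cᵀ·diag(lam_k b_k)·C`, `popov_le_of_slab`,
  `V_le_upperMatrix_of_slab` (`V(x) ≤ xᵀ(P + Cᵀ diag(lam b) C)x` on the closed slab),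
  `V_le_mul_of_slab` (`V(x) ≤ p₂|x|²` from ONE more exact PSD fact `p₂·1 − upperMatrix ⪰ 0`);
* §3 **THE RATE THEOREMS** (on top of, and with exactly the hypotheses of,
  `well_subset_regionOfAttraction`): for every global solution `X` from a point of the certified well
  `{x ∈ slab γ : V ≤ c}` and every `t ≥ 0`,
  `V_le_mul_exp_neg_of_well` — `V(X t) ≤ V(X 0)·e^{−(η/p₂)t}`;
  `dotProduct_le_mul_exp_neg_of_well` — `|X t|² ≤ (p₂/ε)·|X 0|²·e^{−(η/p₂)t}` (`|x|² = xᵀx`);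
  `sqrt_dotProduct_le_of_well` — `|X t| ≤ √(p₂/ε)·|X 0|·e^{−(η/(2p₂))t}`:
  Khalil's `(k₁, k₂, k₃, a) = (ε, p₂, η, 2)`.

THREE COLUMNS. CERTIFIED: for the MODEL `ẋ = Ax − BF(Cx)` of the instance and CLASS = the
certified well, every motion's Euclidean state deviation from the equilibrium decays at least like
`√(p₂/ε)·e^{−t/T}` with the certified TIME CONSTANT `T = 2p₂/η` — a statement about the model inside
the certified region (inner estimate), on top of the parent ROA row; an instance supplies the single
rational `p₂` and decides `p₂·1 − (P + Cᵀ diag(lam b) C) ⪰ 0` exactly. VALIDATED beside it: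
simulated decay, small-signal damping ratios. MODELLED: as the instance's parent row. Nothing here
says a grid is stable or well damped.
-/

noncomputable section

open Real Set Filter Matrix Finset
open scoped Topology

namespace Literature.MathematicalPhysics.PowerSystems.LyapunovFunctionFamily

variable {ι κ : Type*} [Fintype ι] [Fintype κ] [DecidableEq ι] [DecidableEq κ]

/-! ## §1 The Popov integral is at most `(b/2)·y²` on the window -/

/-- Mean-value slope form of the channel nonlinearity: `sin(δ* + y) − sin δ* = y·cos ξ` for some
`ξ` with `|ξ − δ*| ≤ γ`, when `0 < |y| ≤ γ` (the step inside `sector_of_cos_bounds`).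
[cite: Pai1981, §2.15 eqs. (2.47)–(2.48)] -/
private theorem exists_cos_slope {δs γ y : ℝ} (hy : |y| ≤ γ) (h0 : y ≠ 0) :
    ∃ ξ, |ξ - δs| ≤ γ ∧ Real.sin (δs + y) - Real.sin δs = y * Real.cos ξ := by
  rcases lt_or_gt_of_ne h0 with hneg | hpos
  · obtain ⟨ξ, hmem, hd⟩ := exists_hasDerivAt_eq_slope Real.sin Real.cos
      (by linarith : δs + y < δs) Real.continuous_sin.continuousOn
      (fun x _ => Real.hasDerivAt_sin x)
    refine ⟨ξ, ?_, ?_⟩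
    · rw [abs_le]
      constructor <;> nlinarith [hmem.1, hmem.2, abs_le.1 hy]
    · have hne : δs - (δs + y) ≠ 0 := by intro h; apply h0; linarith
      have hd' : Real.cos ξ * (δs - (δs + y)) = Real.sin δs - Real.sin (δs + y) := by
        rw [hd, div_mul_cancel₀ _ hne]
      linarith
  · obtain ⟨ξ, hmem, hd⟩ := exists_hasDerivAt_eq_slope Real.sin Real.cos
      (by linarith : δs < δs + y) Real.continuous_sin.continuousOn
      (fun x _ => Real.hasDerivAt_sin x)
    refine ⟨ξ, ?_, ?_⟩
    · rw [abs_le]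
      constructor <;> nlinarith [hmem.1, hmem.2, abs_le.1 hy]
    · have hne : δs + y - δs ≠ 0 := by intro h; apply h0; linarith
      have hd' : Real.cos ξ * (δs + y - δs) = Real.sin (δs + y) - Real.sin δs := by
        rw [hd, div_mul_cancel₀ _ hne]
      linarith

/-- **The Popov integral is at most `(b/2)·y²` on the window**: if `cos ξ ≤ b` for every `ξ` with
`|ξ − δ*| ≤ γ`, then `∫₀^y F = cos δ* − cos(δ* + y) − y sin δ* ≤ (b/2)·y²` for `|y| ≤ γ` (with
`ψ(u) = (b/2)u² − ∫₀^u F`: `ψ(0) = 0` and `ψ'(u) = b u − F(u) = u (b − cos ξ_u)` has the sign of `u`,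
so `ψ(y) = ψ'(ζ)·y ≥ 0` by the mean value theorem). The upper companion of `popov_term_nonneg`.
[cite: Pai1981, §2.15 eqs. (2.47)–(2.48) and §2.16 eq. (2.63)] -/
theorem popov_term_le {δs γ b : ℝ} (hcos : ∀ ξ, |ξ - δs| ≤ γ → Real.cos ξ ≤ b) {y : ℝ}
    (hy : |y| ≤ γ) : Real.cos δs - Real.cos (δs + y) - y * Real.sin δs ≤ b / 2 * y ^ 2 := by
  rcases eq_or_ne y 0 with h0 | h0
  · simp [h0]
  -- ψ(u) = (b/2) u² − (cos δs − cos(δs + u) − u sin δs), ψ' (u) = b u − F(u)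
  set ψ : ℝ → ℝ := fun u => b / 2 * u ^ 2 - (Real.cos δs - Real.cos (δs + u) - u * Real.sin δs)
    with hψ
  have hψd : ∀ u, HasDerivAt ψ (b * u - (Real.sin (δs + u) - Real.sin δs)) u := by
    intro u
    have h1 : HasDerivAt (fun u : ℝ => Real.cos (δs + u)) (-Real.sin (δs + u) * 1) u :=
      ((hasDerivAt_id u).const_add δs).cos
    have h2 : HasDerivAt (fun u : ℝ => u * Real.sin δs) (1 * Real.sin δs) u :=
      (hasDerivAt_id u).mul_const _
    have h3 : HasDerivAt (fun u : ℝ => b / 2 * u ^ 2) (b / 2 * (2 * u ^ 1 * 1)) u :=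
      ((hasDerivAt_id u).pow 2).const_mul _
    exact (h3.sub (((hasDerivAt_const u (Real.cos δs)).sub h1).sub h2)).congr_deriv (by ring)
  have hψ0 : ψ 0 = 0 := by simp [hψ]
  -- the sign of `ψ'(ζ)·y` for `ζ` strictly between `0` and `y`
  have hsign : ∀ ζ, ζ ≠ 0 → |ζ| ≤ γ → 0 < ζ * y →
      0 ≤ (b * ζ - (Real.sin (δs + ζ) - Real.sin δs)) * y := by
    intro ζ hζ0 hζ hζy
    obtain ⟨ξ, hξ, hF⟩ := exists_cos_slope (δs := δs) hζ hζ0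
    rw [hF]
    have e : (b * ζ - ζ * Real.cos ξ) * y = ζ * y * (b - Real.cos ξ) := by ring
    rw [e]
    exact mul_nonneg hζy.le (by linarith [hcos ξ hξ])
  have hgoal : 0 ≤ ψ y := by
    rcases lt_or_gt_of_ne h0 with hneg | hpos
    · obtain ⟨ζ, hmem, hd⟩ := exists_hasDerivAt_eq_slope ψ _ hneg
        (HasDerivAt.continuousOn fun u _ => hψd u) (fun u _ => hψd u)
      have hζ : |ζ| ≤ γ := by
        rw [abs_le]; constructor <;> nlinarith [hmem.1, hmem.2, abs_le.1 hy]
      have hζ0 : ζ ≠ 0 := ne_of_lt hmem.2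
      have hζy : 0 < ζ * y := mul_pos_of_neg_of_neg (by linarith [hmem.2]) hneg
      have hne : (0 : ℝ) - y ≠ 0 := by intro h; apply h0; linarith
      rw [hψ0] at hd
      have hd' : (b * ζ - (Real.sin (δs + ζ) - Real.sin δs)) * (0 - y) = 0 - ψ y := by
        rw [hd, div_mul_cancel₀ _ hne]
      have := hsign ζ hζ0 hζ hζy
      nlinarith
    · obtain ⟨ζ, hmem, hd⟩ := exists_hasDerivAt_eq_slope ψ _ hpos
        (HasDerivAt.continuousOn fun u _ => hψd u) (fun u _ => hψd u)
      have hζ : |ζ| ≤ γ := by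
        rw [abs_le]; constructor <;> nlinarith [hmem.1, hmem.2, abs_le.1 hy]
      have hζ0 : ζ ≠ 0 := ne_of_gt hmem.1
      have hζy : 0 < ζ * y := mul_pos hmem.1 hpos
      have hne : y - 0 ≠ 0 := by intro h; apply h0; linarith
      rw [hψ0] at hd
      have hd' : (b * ζ - (Real.sin (δs + ζ) - Real.sin δs)) * (y - 0) = ψ y - 0 := by
        rw [hd, div_mul_cancel₀ _ hne]
      have := hsign ζ hζ0 hζ hζy
      nlinarith
  have : ψ y = b / 2 * y ^ 2 - (Real.cos δs - Real.cos (δs + y) - y * Real.sin δs) := rfl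
  linarith

/-! ## §2 The quadratic upper bound of the Lur'e–Postnikov function on the slab -/

namespace SlabCertificate

variable {S : System ι κ} (Λ : SlabCertificate S)

/-- The upper comparison matrix `P + Cᵀ·diag(lam_k b_k)·C` of the certificate (the quadratic form
dominating `V` on the slab). [cite: Pai1981, §2.16 eq. (2.63); Khalil2002, Theorem 4.10 (k₂)] -/
def upperMatrix : Matrix ι ι ℝ :=
  Λ.P + S.Cᵀ * Matrix.diagonal (fun k => Λ.lam k * Λ.b k) * S.C

/-- Unfolding lemma for `upperMatrix`. [cite: Pai1981, §2.16 eq. (2.63)] -/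
theorem upperMatrix_def :
    Λ.upperMatrix = Λ.P + S.Cᵀ * Matrix.diagonal (fun k => Λ.lam k * Λ.b k) * S.C := rfl

/-- The quadratic form of the upper matrix: `xᵀ(P + Cᵀ diag(lam b) C)x = xᵀPx + Σ_k lam_k b_k y_k²`,
`y = Cx`. [cite: Pai1981, §2.16 eq. (2.63)] -/
theorem dotProduct_upperMatrix_mulVec (x : ι → ℝ) :
    x ⬝ᵥ (Λ.upperMatrix *ᵥ x)
      = x ⬝ᵥ (Λ.P *ᵥ x) + ∑ k, Λ.lam k * Λ.b k * (S.C *ᵥ x) k ^ 2 := by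
  rw [upperMatrix, Matrix.add_mulVec, dotProduct_add]
  congr 1
  rw [← Matrix.mulVec_mulVec, ← Matrix.mulVec_mulVec, Matrix.dotProduct_mulVec,
    Matrix.vecMul_transpose]
  simp only [dotProduct, Matrix.mulVec_diagonal]
  refine Finset.sum_congr rfl fun k _ => ?_
  ring

/-- **The Popov part is at most `Σ_k lam_k (b_k/2) y_k²` on the closed slab** (`lam_k ≥ 0` and
`popov_term_le` channel by channel). [cite: Pai1981, §2.16 eq. (2.63); §2.15 (2.47)–(2.48)] -/
theorem popov_le_of_slab {γ : κ → ℝ}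
    (hsec : ∀ k ξ, |ξ - S.δs k| ≤ γ k → Λ.a k ≤ Real.cos ξ ∧ Real.cos ξ ≤ Λ.b k)
    {x : ι → ℝ} (hx : ∀ k, |(S.C *ᵥ x) k| ≤ γ k) :
    Λ.popov x ≤ ∑ k, Λ.lam k * (Λ.b k / 2 * (S.C *ᵥ x) k ^ 2) := by
  unfold popov
  refine Finset.sum_le_sum fun k _ => ?_
  exact mul_le_mul_of_nonneg_left
    (popov_term_le (fun ξ hξ => (hsec k ξ hξ).2) (hx k)) (Λ.lam_nonneg k)

/-- **`V ≤ xᵀ(P + Cᵀ diag(lam b) C)x` on the closed slab.**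
[cite: Pai1981, §2.16 eq. (2.63); Khalil2002, Theorem 4.10 (hypothesis (4.25), upper half)] -/
theorem V_le_upperMatrix_of_slab {γ : κ → ℝ}
    (hsec : ∀ k ξ, |ξ - S.δs k| ≤ γ k → Λ.a k ≤ Real.cos ξ ∧ Real.cos ξ ≤ Λ.b k)
    {x : ι → ℝ} (hx : ∀ k, |(S.C *ᵥ x) k| ≤ γ k) :
    Λ.V x ≤ x ⬝ᵥ (Λ.upperMatrix *ᵥ x) := by
  rw [Λ.dotProduct_upperMatrix_mulVec]
  have hp := Λ.popov_le_of_slab hsec hx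
  have e : ∑ k, Λ.lam k * (Λ.b k / 2 * (S.C *ᵥ x) k ^ 2)
      = (∑ k, Λ.lam k * Λ.b k * (S.C *ᵥ x) k ^ 2) / 2 := by
    rw [Finset.sum_div]
    refine Finset.sum_congr rfl fun k _ => ?_
    ring
  unfold V
  linarith

/-- **`V ≤ p₂|x|²` on the closed slab from ONE exact PSD fact** `p₂·1 − (P + Cᵀ diag(lam b) C) ⪰ 0`
(Khalil's `k₂`). [cite: Khalil2002, Theorem 4.10 (hypothesis (4.25)); Pai1981, §2.16 eq. (2.63)] -/
theorem V_le_mul_of_slab {γ : κ → ℝ} {p₂ : ℝ}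
    (hp₂ : (p₂ • (1 : Matrix ι ι ℝ) - Λ.upperMatrix).PosSemidef)
    (hsec : ∀ k ξ, |ξ - S.δs k| ≤ γ k → Λ.a k ≤ Real.cos ξ ∧ Real.cos ξ ≤ Λ.b k)
    {x : ι → ℝ} (hx : ∀ k, |(S.C *ᵥ x) k| ≤ γ k) : Λ.V x ≤ p₂ * (x ⬝ᵥ x) := by
  have h := hp₂.dotProduct_mulVec_nonneg x
  rw [star_trivial, Matrix.sub_mulVec, Matrix.smul_mulVec, Matrix.one_mulVec, dotProduct_sub,
    dotProduct_smul, smul_eq_mul] at h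
  have hV := Λ.V_le_upperMatrix_of_slab hsec hx
  linarith

/-! ## §3 The rate theorems on the certified well -/

/-- **Exponential decay of `V` in the certified well.** Under the hypotheses of
`well_subset_regionOfAttraction` (`hsec`, `hfr`) and the upper PSD fact `p₂·1 − upperMatrix ⪰ 0`
(`p₂ > 0`), every global solution `X` from a point of the well `{x ∈ slab γ : V ≤ c}` satisfies
`V(X t) ≤ V(X 0)·e^{−(η/p₂)t}` for all `t ≥ 0` (`V̇ ≤ −η|x|² ≤ −(η/p₂)V` in the well, which is
positively invariant). [cite: Khalil2002, Theorem 4.10 (proof: V̇ ≤ −(k₃/k₂)V); Pai1981, §2.16 Theorem [18]] -/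
theorem V_le_mul_exp_neg_of_well {γ : κ → ℝ}
    (hsec : ∀ k ξ, |ξ - S.δs k| ≤ γ k → Λ.a k ≤ Real.cos ξ ∧ Real.cos ξ ≤ Λ.b k)
    {c : ℝ} (hfr : ∀ x ∈ frontier (S.slab γ), c < Λ.V x)
    {p₂ : ℝ} (hp : 0 < p₂) (hp₂ : (p₂ • (1 : Matrix ι ι ℝ) - Λ.upperMatrix).PosSemidef)
    {X : ℝ → ι → ℝ}
    (hX : ∀ T : ℝ, ∀ t ∈ Icc 0 T, HasDerivWithinAt X (S.field (X t)) (Icc 0 T) t)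
    (hX0 : X 0 ∈ S.slab γ) (hXc : Λ.V (X 0) ≤ c) {t : ℝ} (ht : 0 ≤ t) :
    Λ.V (X t) ≤ Λ.V (X 0) * Real.exp (-(Λ.η / p₂) * t) := by
  obtain ⟨-, hall⟩ := Λ.well_subset_regionOfAttraction hsec hfr hX0 hXc
  have hstay := (hall X rfl hX).1
  have hdiff := (Λ.contDiff_V (n := 1)).differentiable one_ne_zero
  refine Literature.Analysis.ODE.comp_le_mul_exp_neg_of_solution₀ (hX t)
    (V' := fun x => fderiv ℝ Λ.V x) (fun s _ => (hdiff _).hasFDerivAt) ?_ ⟨ht, le_rfl⟩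
  intro s hs
  have hsl : ∀ k, |(S.C *ᵥ X s) k| ≤ γ k := fun k => ((hstay s hs.1).1 k).le
  show fderiv ℝ Λ.V (X s) (S.field (X s)) ≤ -(Λ.η / p₂) * Λ.V (X s)
  have h1 := Λ.fderiv_V_field_le (X s)
  have h2 := Λ.sectorForm_nonpos_of_slab hsec hsl
  have h3 := Λ.V_le_mul_of_slab hp₂ hsec hsl
  have h4 : Λ.η / p₂ * Λ.V (X s) ≤ Λ.η / p₂ * (p₂ * (X s ⬝ᵥ X s)) :=
    mul_le_mul_of_nonneg_left h3 (div_nonneg Λ.η_pos.le hp.le)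
  have h5 : Λ.η / p₂ * (p₂ * (X s ⬝ᵥ X s)) = Λ.η * (X s ⬝ᵥ X s) := by
    field_simp
  linarith

/-- **THE RATE THEOREM (squared Euclidean norm).** Under the hypotheses of
`well_subset_regionOfAttraction` and the upper PSD fact `p₂·1 − (P + Cᵀ diag(lam b) C) ⪰ 0`
(`p₂ > 0`), every global solution `X` from a point of the certified well satisfies, for all `t ≥ 0`,
`|X t|² ≤ (p₂/ε)·|X 0|²·e^{−(η/p₂)t}` (`|x|² = xᵀx`; Khalil's Theorem 4.10 with
`(k₁, k₂, k₃, a) = (ε, p₂, η, 2)`: `ε|x|² ≤ V ≤ p₂|x|²`, `V̇ ≤ −η|x|²` in the invariant well).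
CERTIFIED for the MODEL `ẋ = Ax − BF(Cx)`, CLASS = the certified well; a priori over all
solutions. [cite: Khalil2002, Theorem 4.10; Pai1981, §2.16 Theorem [18] eq. (2.63)] -/
theorem dotProduct_le_mul_exp_neg_of_well {γ : κ → ℝ}
    (hsec : ∀ k ξ, |ξ - S.δs k| ≤ γ k → Λ.a k ≤ Real.cos ξ ∧ Real.cos ξ ≤ Λ.b k)
    {c : ℝ} (hfr : ∀ x ∈ frontier (S.slab γ), c < Λ.V x)
    {p₂ : ℝ} (hp : 0 < p₂) (hp₂ : (p₂ • (1 : Matrix ι ι ℝ) - Λ.upperMatrix).PosSemidef)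
    {X : ℝ → ι → ℝ}
    (hX : ∀ T : ℝ, ∀ t ∈ Icc 0 T, HasDerivWithinAt X (S.field (X t)) (Icc 0 T) t)
    (hX0 : X 0 ∈ S.slab γ) (hXc : Λ.V (X 0) ≤ c) {t : ℝ} (ht : 0 ≤ t) :
    X t ⬝ᵥ X t ≤ p₂ / Λ.ε * (X 0 ⬝ᵥ X 0) * Real.exp (-(Λ.η / p₂) * t) := by
  obtain ⟨-, hall⟩ := Λ.well_subset_regionOfAttraction hsec hfr hX0 hXc
  have hstay := (hall X rfl hX).1
  have hdiff := (Λ.contDiff_V (n := 1)).differentiable one_ne_zero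
  have hsl : ∀ s ∈ Icc 0 t, ∀ k, |(S.C *ᵥ X s) k| ≤ γ k :=
    fun s hs k => ((hstay s hs.1).1 k).le
  have h := Literature.Analysis.ODE.gauge_le_mul_exp_neg_of_solution (hX t) (convex_Icc 0 t)
    Subset.rfl (V' := fun x => fderiv ℝ Λ.V x) (fun s _ => (hdiff _).hasFDerivAt)
    (N := fun x : ι → ℝ => x ⬝ᵥ x) Λ.ε_pos hp Λ.η_pos.le
    (fun s hs => (Λ.le_V_of_slab hsec (hsl s hs)).1)
    (fun s hs => Λ.V_le_mul_of_slab hp₂ hsec (hsl s hs))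
    (fun s hs => by
      show fderiv ℝ Λ.V (X s) (S.field (X s)) ≤ -Λ.η * (X s ⬝ᵥ X s)
      have h1 := Λ.fderiv_V_field_le (X s)
      have h2 := Λ.sectorForm_nonpos_of_slab hsec (hsl s hs)
      linarith)
    (a := 0) (b := t) ⟨le_rfl, ht⟩ ⟨ht, le_rfl⟩ ht
  simpa using h

/-- **THE RATE THEOREM (Euclidean norm; the certified time constant `2p₂/η`).** Under the same
hypotheses, `|X t| ≤ √(p₂/ε)·|X 0|·e^{−(η/(2p₂))t}` for all `t ≥ 0`, where `|x| = √(xᵀx)`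
("`‖x(t)‖ ≤ (k₂/k₁)^{1/a}‖x(t₀)‖e^{−(k₃/(k₂a))(t−t₀)}`" with `a = 2`).
[cite: Khalil2002, Theorem 4.10 and Definition 4.5; Pai1981, §2.16 Theorem [18]] -/
theorem sqrt_dotProduct_le_of_well {γ : κ → ℝ}
    (hsec : ∀ k ξ, |ξ - S.δs k| ≤ γ k → Λ.a k ≤ Real.cos ξ ∧ Real.cos ξ ≤ Λ.b k)
    {c : ℝ} (hfr : ∀ x ∈ frontier (S.slab γ), c < Λ.V x)
    {p₂ : ℝ} (hp : 0 < p₂) (hp₂ : (p₂ • (1 : Matrix ι ι ℝ) - Λ.upperMatrix).PosSemidef)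
    {X : ℝ → ι → ℝ}
    (hX : ∀ T : ℝ, ∀ t ∈ Icc 0 T, HasDerivWithinAt X (S.field (X t)) (Icc 0 T) t)
    (hX0 : X 0 ∈ S.slab γ) (hXc : Λ.V (X 0) ≤ c) {t : ℝ} (ht : 0 ≤ t) :
    Real.sqrt (X t ⬝ᵥ X t)
      ≤ Real.sqrt (p₂ / Λ.ε) * Real.sqrt (X 0 ⬝ᵥ X 0) * Real.exp (-(Λ.η / (2 * p₂)) * t) := by
  have h := Λ.dotProduct_le_mul_exp_neg_of_well hsec hfr hp hp₂ hX hX0 hXc ht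
  have hq : 0 ≤ p₂ / Λ.ε := div_nonneg hp.le Λ.ε_pos.le
  have hx0 : 0 ≤ X 0 ⬝ᵥ X 0 := Finset.sum_nonneg fun i _ => mul_self_nonneg (X 0 i)
  have hexp : Real.sqrt (Real.exp (-(Λ.η / p₂) * t)) = Real.exp (-(Λ.η / (2 * p₂)) * t) := by
    rw [Real.sqrt_eq_iff_mul_self_eq (Real.exp_pos _).le (Real.exp_pos _).le, ← Real.exp_add]
    congr 1
    field_simp
    ring
  calc Real.sqrt (X t ⬝ᵥ X t)
      ≤ Real.sqrt (p₂ / Λ.ε * (X 0 ⬝ᵥ X 0) * Real.exp (-(Λ.η / p₂) * t)) :=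
        Real.sqrt_le_sqrt h
    _ = Real.sqrt (p₂ / Λ.ε) * Real.sqrt (X 0 ⬝ᵥ X 0) * Real.exp (-(Λ.η / (2 * p₂)) * t) := by
        rw [Real.sqrt_mul (mul_nonneg hq hx0), Real.sqrt_mul hq, hexp]


/-! ## §4 Certified settling time into a target ball (APPEND) -/

/-- **Certified settling time.** Under the hypotheses of `dotProduct_le_mul_exp_neg_of_well`, for every
target radius² `ρ > 0`: once `t ≥ (p₂/η)·log((p₂/ε)·|X 0|²/ρ)` (and `t ≥ 0`), the state satisfies
`|X t|² ≤ ρ` — the time to enter (and, the bound being monotone, stay below the bound inside) the ball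
`{|x|² ≤ ρ}` is at most `T·log(K|x₀|²/ρ)` with the certified time constant `T = p₂/η` and amplitude
`K = p₂/ε` (Khalil's exponential estimate solved for `t`). [cite: Khalil2002, Theorem 4.10 and Definition 4.5] -/
theorem dotProduct_le_of_settlingTime_le {γ : κ → ℝ}
    (hsec : ∀ k ξ, |ξ - S.δs k| ≤ γ k → Λ.a k ≤ Real.cos ξ ∧ Real.cos ξ ≤ Λ.b k)
    {c : ℝ} (hfr : ∀ x ∈ frontier (S.slab γ), c < Λ.V x)
    {p₂ : ℝ} (hp : 0 < p₂) (hp₂ : (p₂ • (1 : Matrix ι ι ℝ) - Λ.upperMatrix).PosSemidef)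
    {X : ℝ → ι → ℝ}
    (hX : ∀ T : ℝ, ∀ t ∈ Icc 0 T, HasDerivWithinAt X (S.field (X t)) (Icc 0 T) t)
    (hX0 : X 0 ∈ S.slab γ) (hXc : Λ.V (X 0) ≤ c) {ρ : ℝ} (hρ : 0 < ρ) {t : ℝ} (ht : 0 ≤ t)
    (hT : p₂ / Λ.η * Real.log (p₂ / Λ.ε * (X 0 ⬝ᵥ X 0) / ρ) ≤ t) :
    X t ⬝ᵥ X t ≤ ρ := by
  have h := Λ.dotProduct_le_mul_exp_neg_of_well hsec hfr hp hp₂ hX hX0 hXc ht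
  set K : ℝ := p₂ / Λ.ε * (X 0 ⬝ᵥ X 0) with hK
  have hK0 : 0 ≤ K := mul_nonneg (div_nonneg hp.le Λ.ε_pos.le)
    (Finset.sum_nonneg fun i _ => mul_self_nonneg (X 0 i))
  rcases hK0.eq_or_lt with hK00 | hKpos
  · -- `K = 0`: the bound is `0 ≤ ρ`
    have : X t ⬝ᵥ X t ≤ 0 := by rw [← hK00] at h; simpa using h
    linarith
  · -- `K > 0`: `e^{−(η/p₂)t} ≤ ρ/K`
    have hημ : 0 < Λ.η / p₂ := div_pos Λ.η_pos hp
    have hη : Λ.η ≠ 0 := Λ.η_pos.ne'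
    have hpne : p₂ ≠ 0 := hp.ne'
    have hlog : Real.log (K / ρ) ≤ Λ.η / p₂ * t := by
      have h2 : Λ.η / p₂ * (p₂ / Λ.η * Real.log (K / ρ)) ≤ Λ.η / p₂ * t :=
        mul_le_mul_of_nonneg_left hT hημ.le
      have h3 : Λ.η / p₂ * (p₂ / Λ.η * Real.log (K / ρ)) = Real.log (K / ρ) := by
        field_simp
      linarith
    have hexp : Real.exp (-(Λ.η / p₂) * t) ≤ ρ / K := by
      have hKρ : 0 < K / ρ := div_pos hKpos hρ
      calc Real.exp (-(Λ.η / p₂) * t) = Real.exp (-(Λ.η / p₂ * t)) := by ring_nf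
        _ ≤ Real.exp (-Real.log (K / ρ)) := Real.exp_le_exp.2 (by linarith)
        _ = ρ / K := by rw [Real.exp_neg, Real.exp_log hKρ, inv_div]
    calc X t ⬝ᵥ X t ≤ K * Real.exp (-(Λ.η / p₂) * t) := by rw [hK]; exact h
      _ ≤ K * (ρ / K) := mul_le_mul_of_nonneg_left hexp hK0
      _ = ρ := by field_simp

end SlabCertificate

end Literature.MathematicalPhysics.PowerSystems.LyapunovFunctionFamily

end
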